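import Summits.BirchSwinnertonDyer.BirchSwinnertonDyer.Theorems.QuadraticBranchSignedControlPlusEtaNonsurjCartanFieldFrobenius
import Literature.NumberTheory.EllipticCurves.ModPIrreducibleCongruenceTransferProofs
import Mathlib.NumberTheory.LegendreSymbol.Basic
import Mathlib.LinearAlgebra.Trace
import Mathlib.LinearAlgebra.Determinant
import HarnessLib

/-!
# Route `QuadraticBranchSignedControl` (rung K8, cell `bsd-potss`): crux stmt-BirchSwinnertonDyer-19606
# `PlusEtaMainConjectureNonsurj` — THE GOOD PRIMES OF A ROW: the DISCRIMINANT LAW `(a_ℓ² − 4ℓ | p) ≠ 1 ∨ p ∣ a_ℓ`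
# and the FROBENIUS SQUARE `Frob_ℓ² = −ℓ` on `V[p]` when `p ∣ a_ℓ`

WHAT. Companion of `…PlusEtaNonsurjCartanFieldFrobenius` (k8eta-c2 g9: `p ∤ a_ℓ(V) ⟹ Frob_ℓ ∈ H_V`; `Frob_ℓ ∉ H_V ⟹ p ∣ a_ℓ`)
and of the multiplicative-prime laws of k8eta-c2 g12. On a row of crux 19606 (`V/ℚ` globally minimal, `p ≥ 5` good,
`a_p = 0`, `p`-adic tower not onto, so `Im ρ̄_{V,p} = C_ns⁺(p)` in a frame `(e, ε)`, `ε` a non-square) and for a GOOD prime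
`ℓ ≠ p` with an arithmetic Frobenius `σ` at some `𝔓 ∣ ℓ`:

* §1 matrix algebra: `mulVec_mulVec_eq_neg_det_smul_of_trace_eq_zero` — Cayley–Hamilton for a `2 × 2` matrix of trace `0`:
  `M(Mx) = −det(M)·x`; the discriminant on `C_ns⁺(ε)`: for `M = (a, εb; b, a) ∈ C_ns(ε)`: `tr² − 4 det = ε(2b)²`
  (`trace_sq_sub_four_det_of_mem_nonsplitCartan`), hence `tr² − 4 det` is `0` or a NON-SQUARE
  (`trace_sq_sub_four_det_eq_zero_or_not_isSquare`); for `M` in the other coset `tr M = 0`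
  (`trace_eq_zero_of_not_mem_nonsplitCartan`); so for every `M ∈ C_ns⁺(ε)`: `tr M = 0 ∨ tr² − 4det = 0 ∨ ¬ IsSquare (tr² − 4 det)`
  (`trace_dichotomy_of_mem_nonsplitCartanNormalizer`).
* §2 frames: `det_eq_matrix_det` — the `𝔽_p`-linear determinant of `σ` on `V[p]` is the determinant of its matrix (the
  determinant twin of g9's `trace_eq_matrix_trace`).
* §4 (appended, same seat): **`natCast_eq_one_or_eq_neg_one_of_dvd_eulerFactor[_of_row]`** — a good `ℓ ≠ p` whose Euler factor
  (or the partner's: sign `c = ±1`) has the root `ℓ⁻¹` mod `p` — e.g. an ANOMALOUS prime `p ∣ #Ẽ(𝔽_ℓ)` — is `≡ ±1 (mod p)`: the local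
  terms of the Hatley–Lei/Corpuz–Lei `λ`-transfer at good primes live only at `ℓ ≡ ±1 (mod p)` (twin of g12's multiplicative law).
* §3 rows: **`discr_eq_zero_or_not_isSquare_of_centralizes_sq`** — if `Frob_ℓ ∈ H_V` (`ℓ` SPLIT in the Cartan field `K_V`)
  then `a_ℓ² − 4ℓ ≡ 0` or `a_ℓ² − 4ℓ` is a non-residue mod `p`; **`dvd_frobeniusTrace_or_discr_of_row`** — for EVERY good
  `ℓ ≠ p` of a row: `p ∣ a_ℓ(V)`, or `a_ℓ² − 4ℓ ≡ 0 (mod p)`, or `a_ℓ² − 4ℓ` is a non-residue mod `p` (σ-free: a Frobenius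
  exists); Legendre form **`legendreSym_discr_ne_one_of_row`**: `p ∤ a_ℓ(V) ⟹ (a_ℓ² − 4ℓ | p) ≠ 1`. This is the classical
  `C_ns⁺(p)` signature of the row read prime by prime (Sutherland's image test; Zywina 2015 §1), now a kernel theorem on the
  crux's hypotheses; **`frob_smul_smul_eq_neg_of_dvd_frobeniusTrace_of_row`** — if `p ∣ a_ℓ(V)` then `σ(σP) = −ℓ·P` on
  `V[p]` (`tr ρ̄(σ) = a_ℓ ≡ 0`, `det ρ̄(σ) = ℓ`, Cayley–Hamilton): at the primes INERT in `K_V` (where `p ∣ a_ℓ` by g9) the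
  Frobenius squares to the scalar `−ℓ`.

READING for the crux (FINDING-19606-k8eta-c2-g10/g11): the CM-NEWFORM anchor `θ_ψ` of a row has `a_ℓ(θ_ψ) = 0` at every
`ℓ` inert in `K_V` and `a_ℓ(θ_ψ) = ψ(λ) + ψ(λ̄)` at split `ℓ = λλ̄`; the congruence `a_ℓ(θ_ψ) ≡ a_ℓ(V) (mod 𝔓)` is consistent
with exactly these two laws (`p ∣ a_ℓ(V)` at inert `ℓ` — g9; `a_ℓ(V)² − 4ℓ ≡ ε·□` at split `ℓ` — this file: the reduction of
`(ψ(λ) − ψ(λ̄))² ∈ d_K·ℚ²`, `(d_K | p) = −1` since `p` is inert in `K_V`, g10). g10's census «inert check φ((ℓ)) = −ℓ, 0/17397»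
is `frob_smul_smul_eq_neg_of_dvd_frobeniusTrace_of_row` read through `Ind φ`.

HONEST FRAMING (cell `bsd-potss`, run/shared/lean/pub/bsd-potss/; FULL-BSD rank ≤ 1 programme): TOOL THEOREMS ONLY (no
definition, no named fact, no `sorry`, axioms standard). Nothing is booked; crux 19606 stays OPEN; `BSD(W, p)` is claimed for
no pair. Seat `bsd-potss-k8eta-c2` g13 (prover), `--supports stmt-BirchSwinnertonDyer-19606`.

References: [Serre1972] §2.2 (Cartan subgroups and their normalisers), §4.5; [Serre1981] §8.1 (238) (`tr ρ̄(Frob_ℓ) = a_ℓ`);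
[DarmonDiamondTaylor1995] Prop. 2.8 (a) (`det ρ̄ = χ_p`); [Zywina2015] §1 and Thm. 1.4 (`X_ns⁺(p)`, the Cartan field);
A. Sutherland, «Computing images of Galois representations attached to elliptic curves», Forum Math. Sigma 4 (2016) §3
(signature `(a_ℓ² − 4ℓ | p)`).
-/

set_option autoImplicit false
set_option linter.dupNamespace false

noncomputable section

open scoped Classical NumberField

open Matrix Field IsDedekindDomain NumberField WeierstrassCurve Literature.NumberTheory.EllipticCurves
  Literature.NumberTheory.GaloisRepresentations Literature.NumberTheory.SerreUniformity
  Literature.NumberTheory.EllipticCurves.Rank1Residual Rat.HeightOneSpectrum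

namespace Summit.BirchSwinnertonDyer.BirchSwinnertonDyer.Theorems.EtaCartanField

/-! ## §1 Matrix algebra: Cayley–Hamilton at trace zero; the discriminant `tr² − 4 det` on `C_ns⁺(ε)` -/

section MatrixAlgebra

variable {p : ℕ}

/-- **Cayley–Hamilton at trace zero** for a `2 × 2` matrix: `tr M = 0 ⟹ M(Mx) = −(det M)·x`. [folklore] -/
theorem mulVec_mulVec_eq_neg_det_smul_of_trace_eq_zero {M : Matrix (Fin 2) (Fin 2) (ZMod p)} (htr : M.trace = 0)
    (x : Fin 2 → ZMod p) : M *ᵥ (M *ᵥ x) = -(M.det • x) := by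
  rw [Matrix.mulVec_mulVec]
  have hM : M = !![M 0 0, M 0 1; M 1 0, M 1 1] := by
    ext i j; fin_cases i <;> fin_cases j <;> rfl
  rw [Matrix.trace_fin_two] at htr
  have h11 : M 1 1 = -M 0 0 := by linear_combination htr
  ext i
  rw [hM, Matrix.det_fin_two_of]
  fin_cases i <;> simp [Matrix.mulVec, dotProduct, Fin.sum_univ_two, Matrix.mul_apply, h11] <;> ring

/-- **`tr² − 4 det = ε(2b)²` on the Cartan** `C_ns(ε) = {(a, εb; b, a)}`. [cite: Serre1972, §2.2] -/
theorem trace_sq_sub_four_det_of_mem_nonsplitCartan {ε : ZMod p} {M : Matrix (Fin 2) (Fin 2) (ZMod p)}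
    (hM : M ∈ nonsplitCartan ε) : ∃ c : ZMod p, M.trace ^ 2 - 4 * M.det = ε * c ^ 2 := by
  obtain ⟨a, b, -, rfl⟩ := hM
  refine ⟨2 * b, ?_⟩
  rw [Matrix.trace_fin_two_of, Matrix.det_fin_two_of]
  ring

/-- **On the Cartan, `tr² − 4 det` is `0` or a non-square** (`ε` a non-square, `p` prime). [cite: Serre1972, §2.2] -/
theorem trace_sq_sub_four_det_eq_zero_or_not_isSquare [Fact p.Prime] {ε : ZMod p} (hε : ¬ IsSquare ε)
    {M : Matrix (Fin 2) (Fin 2) (ZMod p)} (hM : M ∈ nonsplitCartan ε) :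
    M.trace ^ 2 - 4 * M.det = 0 ∨ ¬ IsSquare (M.trace ^ 2 - 4 * M.det) := by
  obtain ⟨c, hc⟩ := trace_sq_sub_four_det_of_mem_nonsplitCartan hM
  rw [hc]
  by_cases hc0 : c = 0
  · left; rw [hc0]; ring
  · right
    rintro ⟨s, hs⟩
    apply hε
    refine ⟨s * c⁻¹, ?_⟩
    have hcc : c * c⁻¹ = 1 := mul_inv_cancel₀ hc0
    calc ε = ε * (c * c⁻¹) ^ 2 := by rw [hcc, one_pow, mul_one]
      _ = (ε * c ^ 2) * (c⁻¹ * c⁻¹) := by ring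
      _ = s * c⁻¹ * (s * c⁻¹) := by rw [hs]; ring

/-- **Off the Cartan the trace vanishes**: `M = (c, −εd; d, −c)`. [cite: Serre1972, §2.2] -/
theorem trace_eq_zero_of_not_mem_nonsplitCartan [Fact p.Prime] {ε : ZMod p} {M : Matrix (Fin 2) (Fin 2) (ZMod p)}
    (hM : M ∈ nonsplitCartanNormalizer ε) (hM' : M ∉ nonsplitCartan ε) : M.trace = 0 := by
  obtain ⟨c, d, -, rfl⟩ := exists_eq_coset_of_not_mem_nonsplitCartan hM hM'
  rw [Matrix.trace_fin_two_of]
  ring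

/-- **The `C_ns⁺(ε)` signature of a single matrix**: `tr M = 0`, or `tr² − 4 det = 0`, or `tr² − 4 det` is a non-square.
[cite: Serre1972, §2.2] -/
theorem trace_dichotomy_of_mem_nonsplitCartanNormalizer [Fact p.Prime] {ε : ZMod p} (hε : ¬ IsSquare ε)
    {M : Matrix (Fin 2) (Fin 2) (ZMod p)} (hM : M ∈ nonsplitCartanNormalizer ε) :
    M.trace = 0 ∨ M.trace ^ 2 - 4 * M.det = 0 ∨ ¬ IsSquare (M.trace ^ 2 - 4 * M.det) := by
  by_cases hMC : M ∈ nonsplitCartan ε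
  · exact Or.inr (trace_sq_sub_four_det_eq_zero_or_not_isSquare hε hMC)
  · exact Or.inl (trace_eq_zero_of_not_mem_nonsplitCartan hM hMC)

end MatrixAlgebra

variable {p : ℕ} [hp : Fact p.Prime]

/-! ## §2 Frames: the determinant of `σ` on `V[p]` is the determinant of its matrix -/

section Frame

variable {V : WeierstrassCurve ℚ}

/-- **In a frame `e` the `𝔽_p`-linear determinant of `σ` on `V[p]` is the determinant of its matrix** (twin of
`trace_eq_matrix_trace`). [folklore] -/
theorem det_eq_matrix_det (e : V.geomTorsion p ≃+ (Fin 2 → ZMod p)) {σ : absoluteGaloisGroup ℚ}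
    {M : Matrix (Fin 2) (Fin 2) (ZMod p)} (hσ : ∀ P : V.geomTorsion p, e (σ • P) = M.mulVec (e P)) :
    letI : Module (ZMod p) (V.geomTorsion p) := AddSubgroup.torsionBy.zmodModule
    LinearMap.det ((galoisRepTorsion V p σ).toAdd.toAddMonoidHom.toZModLinearMap p) = M.det := by
  letI : Module (ZMod p) (V.geomTorsion p) := AddSubgroup.torsionBy.zmodModule
  let eL : V.geomTorsion p ≃ₗ[ZMod p] (Fin 2 → ZMod p) :=
    LinearEquiv.ofBijective (e.toAddMonoidHom.toZModLinearMap p) ⟨e.injective, e.surjective⟩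
  have heL : ∀ Q : V.geomTorsion p, eL Q = e Q := fun _ ↦ rfl
  have hconj : Matrix.toLin' M =
      eL.conj ((galoisRepTorsion V p σ).toAdd.toAddMonoidHom.toZModLinearMap p) := by
    refine LinearMap.ext fun v ↦ ?_
    obtain ⟨Q, rfl⟩ := eL.surjective v
    rw [LinearEquiv.conj_apply_apply, eL.symm_apply_apply, heL, heL, Matrix.toLin'_apply]
    change M.mulVec (e Q) = e (σ • Q)
    rw [hσ]
  rw [← LinearMap.det_toLin' M, hconj, LinearEquiv.conj_apply, LinearMap.comp_assoc, LinearMap.det_conj]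

end Frame

/-! ## §3 Rows: the discriminant law at the good primes and the Frobenius square -/

section Row

variable (V : WeierstrassCurve ℚ) [V.IsElliptic] [V.IsGloballyMinimal]

/-- **Split primes: `a_ℓ² − 4ℓ` is `0` or a non-residue mod `p`.** On a curve with image `C_ns⁺(p)` (`p ≠ 2`), for a good
prime `ℓ ≠ p` and an arithmetic Frobenius `σ` at `𝔓 ∣ ℓ` that CENTRALISES THE SQUARES on `V[p]` (`σ ∈ H_V`: `ℓ` split in the
Cartan field): `((a_ℓ² − 4ℓ : ℤ) : 𝔽_p) = 0` or it is not a square — `ρ̄(σ) = (a, εb; b, a)` has `tr = a_ℓ`, `det = ℓ`,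
`tr² − 4det = ε(2b)²`. [cite: Serre1972, §2.2] [cite: Serre1981, §8.1 (238)] [cite: DarmonDiamondTaylor1995, Prop. 2.8 (a)] -/
theorem discr_eq_zero_or_not_isSquare_of_centralizes_sq (hp2 : p ≠ 2) (h : HasModPImageEqNonsplitCartanNormalizer V p)
    (ℓ : ℕ) [Fact ℓ.Prime] (hℓp : ℓ ≠ p) (hgood : V.HasGoodReductionAtPrime ℓ)
    {v : HeightOneSpectrum (𝓞 ℚ)} (hv : (primesEquiv v : ℕ) = ℓ)
    {𝔓 : Ideal (absIntegers (𝓞 ℚ) ℚ)} (h𝔓 : 𝔓 ∈ v.primesAbove) {σ : absoluteGaloisGroup ℚ}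
    (hσ : IsArithFrobAt (𝓞 ℚ) σ 𝔓)
    (hcen : ∀ (τ : absoluteGaloisGroup ℚ) (P : V.geomTorsion p), σ • ((τ * τ) • P) = (τ * τ) • (σ • P)) :
    ((V.frobeniusTrace ℓ ^ 2 - 4 * ℓ : ℤ) : ZMod p) = 0 ∨
      ¬ IsSquare ((V.frobeniusTrace ℓ ^ 2 - 4 * ℓ : ℤ) : ZMod p) := by
  letI : Module (ZMod p) (V.geomTorsion p) := AddSubgroup.torsionBy.zmodModule
  obtain ⟨e, ε, hε, himg, hsurj⟩ := h
  obtain ⟨M, hM, hσM⟩ := himg σ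
  have hMC : M ∈ nonsplitCartan ε :=
    (matrix_mem_nonsplitCartan_iff_centralizes_sq hp2 e hε himg hsurj hM hσM).mpr hcen
  have htr : M.trace = (V.frobeniusTrace ℓ : ZMod p) := by
    rw [← trace_eq_matrix_trace e hσM, V.trace_galoisRepTorsion_frobenius_eq p hℓp hgood hv h𝔓 hσ]
  have hdet : M.det = (ℓ : ZMod p) := by
    rw [← det_eq_matrix_det e hσM, V.det_galoisRepTorsion_frobenius_eq p hℓp hgood hv h𝔓 hσ]
  have hcast : ((V.frobeniusTrace ℓ ^ 2 - 4 * ℓ : ℤ) : ZMod p) = M.trace ^ 2 - 4 * M.det := by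
    rw [htr, hdet]; push_cast; ring
  rw [hcast]
  exact trace_sq_sub_four_det_eq_zero_or_not_isSquare hε hMC

/-- **The discriminant law at every good prime of a curve with image `C_ns⁺(p)`** (`p ≠ 2`): for a good `ℓ ≠ p` and any
arithmetic Frobenius `σ` at `𝔓 ∣ ℓ`: `p ∣ a_ℓ(V)` (this is forced when `σ ∉ H_V`, g9), or `a_ℓ² − 4ℓ ≡ 0 (mod p)`, or
`a_ℓ² − 4ℓ` is a non-residue mod `p` (when `σ ∈ H_V`). [cite: Serre1972, §2.2] [cite: Serre1981, §8.1 (238)] -/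
theorem dvd_frobeniusTrace_or_discr_of_frob (hp2 : p ≠ 2) (h : HasModPImageEqNonsplitCartanNormalizer V p)
    (ℓ : ℕ) [Fact ℓ.Prime] (hℓp : ℓ ≠ p) (hgood : V.HasGoodReductionAtPrime ℓ)
    {v : HeightOneSpectrum (𝓞 ℚ)} (hv : (primesEquiv v : ℕ) = ℓ)
    {𝔓 : Ideal (absIntegers (𝓞 ℚ) ℚ)} (h𝔓 : 𝔓 ∈ v.primesAbove) {σ : absoluteGaloisGroup ℚ}
    (hσ : IsArithFrobAt (𝓞 ℚ) σ 𝔓) :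
    (p : ℤ) ∣ V.frobeniusTrace ℓ ∨ ((V.frobeniusTrace ℓ ^ 2 - 4 * ℓ : ℤ) : ZMod p) = 0 ∨
      ¬ IsSquare ((V.frobeniusTrace ℓ ^ 2 - 4 * ℓ : ℤ) : ZMod p) := by
  by_cases hcen : ∀ (τ : absoluteGaloisGroup ℚ) (P : V.geomTorsion p), σ • ((τ * τ) • P) = (τ * τ) • (σ • P)
  · exact Or.inr (discr_eq_zero_or_not_isSquare_of_centralizes_sq V hp2 h ℓ hℓp hgood hv h𝔓 hσ hcen)
  · exact Or.inl (dvd_frobeniusTrace_of_frob_not_centralizes_sq V hp2 h ℓ hℓp hgood hv h𝔓 hσ hcen)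

/-- **σ-free form**: on a curve with image `C_ns⁺(p)` (`p ≠ 2`), at EVERY good prime `ℓ ≠ p`: `p ∣ a_ℓ(V)`, or
`a_ℓ² − 4ℓ ≡ 0 (mod p)`, or `a_ℓ² − 4ℓ` is a non-residue mod `p` (a Frobenius at a prime above `ℓ` exists:
`exists_isArithFrobAt_of_mem_primesAbove_holds`). [cite: Serre1972, §2.2] [cite: Zywina2015, §1] -/
theorem dvd_frobeniusTrace_or_discr (hp2 : p ≠ 2) (h : HasModPImageEqNonsplitCartanNormalizer V p)
    (ℓ : ℕ) [hℓ : Fact ℓ.Prime] (hℓp : ℓ ≠ p) (hgood : V.HasGoodReductionAtPrime ℓ) :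
    (p : ℤ) ∣ V.frobeniusTrace ℓ ∨ ((V.frobeniusTrace ℓ ^ 2 - 4 * ℓ : ℤ) : ZMod p) = 0 ∨
      ¬ IsSquare ((V.frobeniusTrace ℓ ^ 2 - 4 * ℓ : ℤ) : ZMod p) := by
  obtain ⟨v, hv⟩ : ∃ v : HeightOneSpectrum (𝓞 ℚ), (primesEquiv v : ℕ) = ℓ :=
    ⟨primesEquiv.symm ⟨ℓ, hℓ.out⟩, by rw [Equiv.apply_symm_apply]⟩
  obtain ⟨𝔓, h𝔓⟩ := HeightOneSpectrum.primesAbove_nonempty v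
  obtain ⟨σ, hσ⟩ := HeightOneSpectrum.exists_isArithFrobAt_of_mem_primesAbove_holds h𝔓
  exact dvd_frobeniusTrace_or_discr_of_frob V hp2 h ℓ hℓp hgood hv h𝔓 hσ

/-- **The discriminant law on every row of crux 19606** (`V/ℚ` globally minimal, `p ≥ 5` good, `a_p = 0`, `p`-adic tower
not onto): at EVERY good prime `ℓ ≠ p`: `p ∣ a_ℓ(V)` ∨ `a_ℓ² − 4ℓ ≡ 0 (mod p)` ∨ `a_ℓ² − 4ℓ` is a non-residue mod `p`.
[cite: Serre1972, §2.2] [cite: Zywina2015, §1 and Thm. 1.4] -/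
theorem dvd_frobeniusTrace_or_discr_of_row (p : ℕ) [Fact p.Prime] (hp5 : 5 ≤ p) (hgood : V.HasGoodReductionAtPrime p)
    (hap : V.frobeniusTrace p = 0) (hns : ¬ ∀ m : ℕ, V.HasSurjectiveModNGaloisRep (p ^ m : ℕ))
    (ℓ : ℕ) [Fact ℓ.Prime] (hℓp : ℓ ≠ p) (hgoodℓ : V.HasGoodReductionAtPrime ℓ) :
    (p : ℤ) ∣ V.frobeniusTrace ℓ ∨ ((V.frobeniusTrace ℓ ^ 2 - 4 * ℓ : ℤ) : ZMod p) = 0 ∨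
      ¬ IsSquare ((V.frobeniusTrace ℓ ^ 2 - 4 * ℓ : ℤ) : ZMod p) :=
  dvd_frobeniusTrace_or_discr V (by omega) (hasModPImageEqNonsplitCartanNormalizer_of_row V p hp5 hgood hap hns) ℓ hℓp
    hgoodℓ

/-- **Legendre form of the row law**: on a row of crux 19606, a good prime `ℓ ≠ p` with `p ∤ a_ℓ(V)` has
`(a_ℓ² − 4ℓ | p) ≠ 1`. [cite: Serre1972, §2.2] [cite: Zywina2015, §1 and Thm. 1.4] -/
theorem legendreSym_discr_ne_one_of_row (p : ℕ) [Fact p.Prime] (hp5 : 5 ≤ p) (hgood : V.HasGoodReductionAtPrime p)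
    (hap : V.frobeniusTrace p = 0) (hns : ¬ ∀ m : ℕ, V.HasSurjectiveModNGaloisRep (p ^ m : ℕ))
    (ℓ : ℕ) [Fact ℓ.Prime] (hℓp : ℓ ≠ p) (hgoodℓ : V.HasGoodReductionAtPrime ℓ)
    (ha : ¬ (p : ℤ) ∣ V.frobeniusTrace ℓ) :
    legendreSym p (V.frobeniusTrace ℓ ^ 2 - 4 * ℓ) ≠ 1 := by
  intro h1
  rcases dvd_frobeniusTrace_or_discr_of_row V p hp5 hgood hap hns ℓ hℓp hgoodℓ with h | h | h
  · exact ha h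
  · exact one_ne_zero (h1.symm.trans ((legendreSym.eq_zero_iff p _).mpr h))
  · have h0 : ((V.frobeniusTrace ℓ ^ 2 - 4 * ℓ : ℤ) : ZMod p) ≠ 0 := fun h0 =>
      h ⟨0, by rw [h0, mul_zero]⟩
    exact h ((legendreSym.eq_one_iff p h0).mp h1)

/-- **The Frobenius square at the primes with `p ∣ a_ℓ`.** On a curve with image `C_ns⁺(p)`... in fact for ANY elliptic
`V/ℚ`: at a good `ℓ ≠ p` with `p ∣ a_ℓ(V)`, every arithmetic Frobenius `σ` at `𝔓 ∣ ℓ` satisfies `σ(σP) = −ℓ·P` on `V[p]`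
(`tr ρ̄(σ) = a_ℓ ≡ 0`, `det ρ̄(σ) = ℓ`, Cayley–Hamilton). On a row of crux 19606 this applies at every `ℓ` INERT in the
Cartan field (g9 `dvd_frobeniusTrace_of_frob_not_centralizes_sq`). [cite: Serre1981, §8.1 (238)]
[cite: DarmonDiamondTaylor1995, Prop. 2.8 (a)] -/
theorem frob_smul_smul_eq_neg_of_dvd_frobeniusTrace (e : V.geomTorsion p ≃+ (Fin 2 → ZMod p))
    {σ : absoluteGaloisGroup ℚ} {M : Matrix (Fin 2) (Fin 2) (ZMod p)}
    (hσM : ∀ P : V.geomTorsion p, e (σ • P) = M.mulVec (e P))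
    (ℓ : ℕ) [Fact ℓ.Prime] (hℓp : ℓ ≠ p) (hgood : V.HasGoodReductionAtPrime ℓ) (ha : (p : ℤ) ∣ V.frobeniusTrace ℓ)
    {v : HeightOneSpectrum (𝓞 ℚ)} (hv : (primesEquiv v : ℕ) = ℓ)
    {𝔓 : Ideal (absIntegers (𝓞 ℚ) ℚ)} (h𝔓 : 𝔓 ∈ v.primesAbove) (hσ : IsArithFrobAt (𝓞 ℚ) σ 𝔓) :
    ∀ P : V.geomTorsion p, σ • (σ • P) = -((ℓ : ℤ) • P) := by
  letI : Module (ZMod p) (V.geomTorsion p) := AddSubgroup.torsionBy.zmodModule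
  have htr : M.trace = 0 := by
    rw [← trace_eq_matrix_trace e hσM, V.trace_galoisRepTorsion_frobenius_eq p hℓp hgood hv h𝔓 hσ]
    exact (ZMod.intCast_zmod_eq_zero_iff_dvd _ p).mpr ha
  have hdet : M.det = (ℓ : ZMod p) := by
    rw [← det_eq_matrix_det e hσM, V.det_galoisRepTorsion_frobenius_eq p hℓp hgood hv h𝔓 hσ]
  intro P
  apply e.injective
  rw [hσM, hσM, mulVec_mulVec_eq_neg_det_smul_of_trace_eq_zero htr, hdet, map_neg, map_zsmul,
    ← Int.cast_smul_eq_zsmul (ZMod p), Int.cast_natCast]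

/-- **Row form**: on a row of crux 19606, at a good prime `ℓ ≠ p` whose Frobenius `σ` (at some `𝔓 ∣ ℓ`) does NOT centralise
the squares on `V[p]` — `ℓ` INERT in the Cartan field `K_V` — `σ(σP) = −ℓ·P` on `V[p]`. [cite: Serre1972, §2.2]
[cite: Serre1981, §8.1 (238)] -/
theorem frob_smul_smul_eq_neg_of_not_centralizes_sq_of_row (p : ℕ) [Fact p.Prime] (hp5 : 5 ≤ p)
    (hgood : V.HasGoodReductionAtPrime p) (hap : V.frobeniusTrace p = 0)
    (hns : ¬ ∀ m : ℕ, V.HasSurjectiveModNGaloisRep (p ^ m : ℕ)) (ℓ : ℕ) [Fact ℓ.Prime] (hℓp : ℓ ≠ p)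
    (hgoodℓ : V.HasGoodReductionAtPrime ℓ) {v : HeightOneSpectrum (𝓞 ℚ)} (hv : (primesEquiv v : ℕ) = ℓ)
    {𝔓 : Ideal (absIntegers (𝓞 ℚ) ℚ)} (h𝔓 : 𝔓 ∈ v.primesAbove) {σ : absoluteGaloisGroup ℚ}
    (hσ : IsArithFrobAt (𝓞 ℚ) σ 𝔓)
    (hnot : ¬ ∀ (τ : absoluteGaloisGroup ℚ) (P : V.geomTorsion p), σ • ((τ * τ) • P) = (τ * τ) • (σ • P)) :
    ∀ P : V.geomTorsion p, σ • (σ • P) = -((ℓ : ℤ) • P) := by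
  have himg := hasModPImageEqNonsplitCartanNormalizer_of_row V p hp5 hgood hap hns
  obtain ⟨e, ε, -, hmat, -⟩ := id himg
  obtain ⟨M, -, hσM⟩ := hmat σ
  exact frob_smul_smul_eq_neg_of_dvd_frobeniusTrace V e hσM ℓ hℓp hgoodℓ
    (dvd_frobeniusTrace_of_frob_not_centralizes_sq V (by omega) himg ℓ hℓp hgoodℓ hv h𝔓 hσ hnot) hv h𝔓 hσ

end Row

/-! ## §4 The anomalous primes of a row are `≡ ±1 (mod p)` — where the local terms of the `λ`-transfer can live
(APPENDED by k8eta-c2 g13, same session; decls above byte-identical) -/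

section Anomalous

variable (V : WeierstrassCurve ℚ) [V.IsElliptic] [V.IsGloballyMinimal]

/-- **Anomalous good primes of a curve with image `C_ns⁺(p)` are `≡ ±1 (mod p)`.** Let `Im ρ̄_{V,p} = C_ns⁺(p)` (`p ≠ 2`), `ℓ ≠ p` a
good prime and `c = ±1` a sign with `p ∣ ℓ + 1 − c·a_ℓ(V)` — i.e. `X = ℓ⁻¹` is a root mod `p` of the Euler factor `1 − c·a_ℓ X + ℓ X²`
(`c = 1`: `p ∣ #Ẽ(𝔽_ℓ)`, the ANOMALOUS primes; `c = η(ℓ) = ±1`: the Euler factor of the partner `W = V ⊗ η` at `ℓ`). Then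
`ℓ ≡ 1` or `ℓ ≡ −1 (mod p)`: by the discriminant law (`dvd_frobeniusTrace_or_discr`) either `p ∣ a_ℓ` (then `ℓ ≡ −1`), or
`a_ℓ² − 4ℓ ≡ (ℓ + 1)² − 4ℓ = (ℓ − 1)²` is `0` (then `ℓ ≡ 1`) or a non-residue (impossible: it is a square). READING: in the
`λ`-transfer formula of Hatley–Lei Prop. 5.1 / Corpuz–Lei Thm. 1 the local term at a GOOD prime `ℓ` of the row (branch `ω^i`,
`c = ω^i(ℓ)`) vanishes unless `ℓ ≡ ±1 (mod p)` — the good-prime twin of k8eta-c2 g12's law «every multiplicative `ℓ ≠ p` of a row is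
`≡ ±1 (mod p)`». [cite: Serre1972, §2.2] [cite: Serre1981, §8.1 (238)] [cite: Zywina2015, §1 and Thm. 1.4] -/
theorem natCast_eq_one_or_eq_neg_one_of_dvd_eulerFactor (hp2 : p ≠ 2) (h : HasModPImageEqNonsplitCartanNormalizer V p)
    (ℓ : ℕ) [Fact ℓ.Prime] (hℓp : ℓ ≠ p) (hgood : V.HasGoodReductionAtPrime ℓ) {c : ℤ} (hc : c = 1 ∨ c = -1)
    (hdvd : (p : ℤ) ∣ (ℓ : ℤ) + 1 - c * V.frobeniusTrace ℓ) :
    (ℓ : ZMod p) = 1 ∨ (ℓ : ZMod p) = -1 := by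
  have hc2 : c * c = 1 := by rcases hc with rfl | rfl <;> norm_num
  -- in `𝔽_p`: `c·a_ℓ = ℓ + 1`
  have hrel : (c : ZMod p) * (V.frobeniusTrace ℓ : ZMod p) = (ℓ : ZMod p) + 1 := by
    have h0 : (((ℓ : ℤ) + 1 - c * V.frobeniusTrace ℓ : ℤ) : ZMod p) = 0 :=
      (ZMod.intCast_zmod_eq_zero_iff_dvd _ p).mpr hdvd
    push_cast at h0
    linear_combination -h0
  have hcc : (c : ZMod p) * (c : ZMod p) = 1 := by
    have h := congrArg (Int.cast : ℤ → ZMod p) hc2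
    push_cast at h
    exact h
  -- hence `a_ℓ = c (ℓ + 1)` and `a_ℓ² − 4ℓ = (ℓ − 1)²`
  have ha : (V.frobeniusTrace ℓ : ZMod p) = (c : ZMod p) * ((ℓ : ZMod p) + 1) := by
    linear_combination (c : ZMod p) * hrel - (V.frobeniusTrace ℓ : ZMod p) * hcc
  have hdisc : ((V.frobeniusTrace ℓ ^ 2 - 4 * ℓ : ℤ) : ZMod p) = ((ℓ : ZMod p) - 1) ^ 2 := by
    push_cast
    rw [ha]
    linear_combination ((ℓ : ZMod p) + 1) ^ 2 * hcc
  rcases dvd_frobeniusTrace_or_discr V hp2 h ℓ hℓp hgood with hdiv | hzero | hnsq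
  · -- `p ∣ a_ℓ`: then `ℓ + 1 ≡ 0`
    right
    have ha0 : (V.frobeniusTrace ℓ : ZMod p) = 0 := (ZMod.intCast_zmod_eq_zero_iff_dvd _ p).mpr hdiv
    rw [ha0, mul_zero] at hrel
    linear_combination -hrel
  · -- `(ℓ − 1)² ≡ 0`: then `ℓ ≡ 1`
    left
    rw [hdisc] at hzero
    have h1 : (ℓ : ZMod p) - 1 = 0 := pow_eq_zero_iff (n := 2) (by norm_num) |>.mp hzero
    linear_combination h1
  · -- a square is not a non-square
    exact absurd ⟨(ℓ : ZMod p) - 1, by rw [hdisc]; ring⟩ hnsq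

/-- **Row form**: on a row of crux 19606 (`V/ℚ` globally minimal, `p ≥ 5` good, `a_p = 0`, `p`-adic tower not onto), a good prime
`ℓ ≠ p` at which the Euler factor of `V` (`c = 1`) or of the partner branch (`c = −1`) has the root `ℓ⁻¹` mod `p` — in particular every
ANOMALOUS prime `p ∣ #Ẽ(𝔽_ℓ) = ℓ + 1 − a_ℓ` — satisfies `ℓ ≡ ±1 (mod p)`. [cite: Serre1972, §2.2] [cite: Zywina2015, §1 and Thm. 1.4] -/
theorem natCast_eq_one_or_eq_neg_one_of_dvd_eulerFactor_of_row (p : ℕ) [Fact p.Prime] (hp5 : 5 ≤ p)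
    (hgood : V.HasGoodReductionAtPrime p) (hap : V.frobeniusTrace p = 0)
    (hns : ¬ ∀ m : ℕ, V.HasSurjectiveModNGaloisRep (p ^ m : ℕ)) (ℓ : ℕ) [Fact ℓ.Prime] (hℓp : ℓ ≠ p)
    (hgoodℓ : V.HasGoodReductionAtPrime ℓ) {c : ℤ} (hc : c = 1 ∨ c = -1)
    (hdvd : (p : ℤ) ∣ (ℓ : ℤ) + 1 - c * V.frobeniusTrace ℓ) :
    (ℓ : ZMod p) = 1 ∨ (ℓ : ZMod p) = -1 :=
  natCast_eq_one_or_eq_neg_one_of_dvd_eulerFactor V (by omega)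
    (hasModPImageEqNonsplitCartanNormalizer_of_row V p hp5 hgood hap hns) ℓ hℓp hgoodℓ hc hdvd

/-- **Anomalous primes, the classical case `c = 1`**: on a row of crux 19606, `p ∣ ℓ + 1 − a_ℓ(V) = #Ẽ(𝔽_ℓ)` at a good `ℓ ≠ p`
forces `ℓ ≡ ±1 (mod p)`. [cite: Serre1972, §2.2] [cite: Zywina2015, §1 and Thm. 1.4] -/
theorem natCast_eq_one_or_eq_neg_one_of_anomalous_of_row (p : ℕ) [Fact p.Prime] (hp5 : 5 ≤ p)
    (hgood : V.HasGoodReductionAtPrime p) (hap : V.frobeniusTrace p = 0)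
    (hns : ¬ ∀ m : ℕ, V.HasSurjectiveModNGaloisRep (p ^ m : ℕ)) (ℓ : ℕ) [Fact ℓ.Prime] (hℓp : ℓ ≠ p)
    (hgoodℓ : V.HasGoodReductionAtPrime ℓ) (hdvd : (p : ℤ) ∣ (ℓ : ℤ) + 1 - V.frobeniusTrace ℓ) :
    (ℓ : ZMod p) = 1 ∨ (ℓ : ZMod p) = -1 :=
  natCast_eq_one_or_eq_neg_one_of_dvd_eulerFactor_of_row V p hp5 hgood hap hns ℓ hℓp hgoodℓ (Or.inl rfl) (by simpa using hdvd)

end Anomalous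

end Summit.BirchSwinnertonDyer.BirchSwinnertonDyer.Theorems.EtaCartanField

end
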